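import Summits.QuantumFields.YangMills.Theorems.BalabanUVNodesN15KingModelCovariantLaplacian
import Summits.QuantumFields.YangMills.Theorems.BalabanUVNodesN15KingModelTorusPlaneWaves
import Literature.MathematicalPhysics.QuantumFieldTheory.Balaban1983to89.B9Eq323KatoDomination
import HarnessLib

/-!
# BalabanUVNodes ∕ N15 — THE KING-MODEL RUNG (PART Ͱ-b): KATO DOMINATION — KING's `A = 0` TORUS COVARIANCE `(c(−Δ)+m²)⁻¹` MAJORISES THE COVARIANT FINE COVARIANCE
# `G_U = (−cΔ_U + m²)⁻¹` AT EVERY UNITARY LINK FIELD `U`: `‖(G_U f)(x)‖ ≤ ((c(−Δ)+m²)⁻¹ g)(x)` whenever `‖f‖ ≤ g`; blockwise `‖(G_U)_{xy}‖ ≤ (c(−Δ)+m²)⁻¹(x,y)`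
# (Track A, DAG node N15 = NE2; FAN-OUT v1.1 §N15 s3 «KING-MODEL RUNG … what the curved case adds»; count-neutral)

HONEST FRAMING.  Count-neutral (cell `pub-ymgap`, seat `pub-ymgap-dag-n15-e` g42; `--supports stmt-QuantumFields-27247 --as helper` = K3ᴬ, KEY MAP v3).  One finite torus at fixed
spacing; NOT Bałaban's `G_k(U)`∕(3.42) (the block-averaging penalty is not of Kato form — LOCATED in PART Ͱ-a's header); NOT a node discharge (N15 of record untouched); nothing
continuum ∕ ℝ⁴ ∕ OS ∕ Clay.

THE THEOREM (what the curved case adds to the fine covariance's MAGNITUDES: nothing).  For every period vector `K`, `c ≥ 0`, `m² > 0`, every fibre `𝕜ⁿ` (`𝕜 = ℝ` or `ℂ`) and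
EVERY unitary link field `U` (no smallness, no regularity), the covariant fine covariance `G_U = M_U⁻¹` of PART Ͱ-a is dominated by King's `A = 0` covariance
`G = (lapF K c m²)⁻¹` ([King1986] (4.4) p.670) in the following senses:
* §2 ★★★ **`norm_fib_inv_mulVec_le`** — for every source `f : T × n → 𝕜` and scalar `g : T → ℝ` with `‖f(x)‖_{𝕜ⁿ} ≤ g(x)` for all `x`: `‖(G_U f)(x)‖_{𝕜ⁿ} ≤ (G g)(x)` for all `x`
  (the tree's abstract Kato ∕ maximum-principle letter `B9Eq323KatoDomination.norm_le_scalar_of_resolvent` — [DodziukMathai2006] Lemma 1.2 ∕ proof of Thm 1.5,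
  [Balaban1985BackgroundPropagators] (3.23) — instantiated on King's stencil: neighbour slots `Fin(d+1) × Bool`, weights `c`, transporters `U(x,μ)`, `U(x−e_μ,μ)^*` as
  isometries of `EuclideanSpace 𝕜 n`, scalar shadow = `lapF_mulVec_stencil`); ★★ **`norm_fib_inv_mulVec_le_div_mass`** (`‖(G_Uf)(x)‖ ≤ sup‖f‖∕m²`, `norm_le_of_resolvent`);
* §3 ★★★ **`norm_blk_inv_mulVec_le`** — `‖(G_U)_{xy} e‖ ≤ G(x,y)·‖e‖` for every `e ∈ 𝕜ⁿ` (the source `δ_y ⊗ e`; scalar shadow = the `y`-column of `G`); ★★★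
  **`norm_inv_entry_le_lapF_inv`** — ENTRYWISE `‖G_U((x,i),(y,j))‖ ≤ G(x,y)`; ★★★ **`l2_opNorm_blk_inv_le`** — in the fibre OPERATOR NORM `‖(G_U)_{xy}‖ ≤ G(x,y)`
  (Mathlib's `Matrix.Norms.L2Operator`); `lapF_inv_entry_nonneg` (`G(x,y) ≥ 0` from the scalar maximum principle `scalar_nonneg_of_resolvent`, by name);
* §4 CONSEQUENCES BY NAME — every `A = 0` magnitude bound of PART Ε holds VERBATIM at all `U`: ★★ **`norm_inv_entry_le_diag`** (`≤ G(x,x)`, Ε-e `abs_lapF_inv_le_diag`), ★★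
  **`norm_inv_entry_le_inv_mass`** (`≤ 1∕m²`, Ε-e `lapF_inv_diag_le_inv_mass`), ★★ **`l2_opNorm_blk_inv_le_inv_mass`**, ★ `norm_blk_inv_kingGaugeAct` (the block sizes are GAUGE
  INVARIANT, Ͱ-a `blk_covLapF_kingGaugeAct_inv`); the decay ∕ sum-rule ∕ limit editions (Ε-d, Ϟ-s, Ϟ-x∕y) follow the same one-line pattern and are filed with PART Ͱ-c.

PRIOR TREE ART (by name): Ͱ-a (`covLapF`, `covLapF_mulVec_apply`, `covLapF_mul_inv`, `isUnit_det_covLapF`, `lapF_det_isUnit`, `kingGaugeAct`, `blk_covLapF_kingGaugeAct_inv`),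
`B9Eq323KatoDomination` (`norm_le_scalar_of_resolvent`, `norm_le_of_resolvent`, `scalar_nonneg_of_resolvent`), Ε-b∕e (`lapF_mulVec_stencil`, `abs_lapF_inv_le_diag`,
`lapF_inv_diag_le_inv_mass`), `LatticeDiamagneticInequality` (`blk`), Mathlib (`EuclideanSpace`, `Matrix.toEuclideanLin`, `Matrix.toEuclideanCLM`, `Matrix.Norms.L2Operator`).
Dedup (rg at filing): basename 0 files; needles `fib |kingNbr|kingTransport|norm_fib_inv_mulVec_le|norm_blk_inv_mulVec_le|l2_opNorm_blk_inv_le` 0 tree files.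
Locators: [King1986] (4.4) p.670; [Balaban1985BackgroundPropagators] (3.23) p.394, Thm 3.1 (3.42) p.397 (value row), p.398 l.1–2; [DodziukMathai2006] §1 Lemma 1.1, Lemma 1.2, Thm 1.5,
Remark 1.6.  0 `sorry`, 3 plumbing `def`s (`fib`, `kingNbr`, `kingTransport`).
-/

noncomputable section

open scoped BigOperators ComplexConjugate ComplexOrder Kronecker InnerProductSpace
open Finset Matrix WithLp

namespace Summit.QuantumFields.YangMills.BalabanUVNodes.N15KingModelRung.Covariant

open Literature.MathematicalPhysics.QuantumFieldTheory.LatticeDiamagneticInequality (Hopping blk placed)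
open Literature.MathematicalPhysics.QuantumFieldTheory.Balaban1983to89.B5Prop11Plancherel (Tor unitVec)
open Literature.MathematicalPhysics.QuantumFieldTheory.Balaban1983to89.B9Eq323KatoDomination (norm_le_scalar_of_resolvent norm_le_of_resolvent scalar_nonneg_of_resolvent)
open Literature.MathematicalPhysics.QuantumFieldTheory.King1986.Torus (lapF)
open Summit.QuantumFields.YangMills.BalabanUVNodes.N15KingModelRung.TorusSpectral (lapF_mulVec_stencil abs_lapF_inv_le_diag lapF_inv_diag_le_inv_mass)

variable {d : ℕ} (K : Fin (d + 1) → ℕ)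

/-! ## §1 The Kato data of King's stencil: fibres, neighbour slots, transporters -/

section Data

variable {𝕜 : Type*} [RCLike 𝕜] {n : Type*} [Fintype n] [DecidableEq n]

/-- The FIBRE of a field `v : T × n → 𝕜` at the site `x`, as a vector of `EuclideanSpace 𝕜 n` (so that `‖fib v x‖` is the Euclidean norm `(Σ_i|v(x,i)|²)^{1∕2}`). [folklore] -/
def fib (v : Tor K × n → 𝕜) (x : Tor K) : EuclideanSpace 𝕜 n := toLp 2 fun i => v (x, i)

/-- The NEIGHBOUR SLOTS of King's stencil: `(μ, true) ↦ x + e_μ`, `(μ, false) ↦ x − e_μ`. [cite: King1986, (4.4) p.670] -/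
def kingNbr (x : Tor K) (j : Fin (d + 1) × Bool) : Tor K := if j.2 then x + unitVec K j.1 else x - unitVec K j.1

/-- The TRANSPORTERS of the covariant stencil on the slots: forward `U(x,μ)` on `(μ, true)`, backward `U(x−e_μ,μ)^*` on `(μ, false)`, as linear maps of `EuclideanSpace 𝕜 n`.
[cite: Balaban1985BackgroundPropagators, (3.3) p.391, (3.23) p.394] -/
def kingTransport (U : Tor K × Fin (d + 1) → Matrix n n 𝕜) (x : Tor K) (j : Fin (d + 1) × Bool) : EuclideanSpace 𝕜 n →ₗ[𝕜] EuclideanSpace 𝕜 n :=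
  if j.2 then Matrix.toEuclideanLin (U (x, j.1)) else Matrix.toEuclideanLin (U (x - unitVec K j.1, j.1))ᴴ

omit [RCLike 𝕜] [Fintype n] [DecidableEq n] in
/-- Components of a fibre. [folklore] -/
@[simp] theorem fib_apply (v : Tor K × n → 𝕜) (x : Tor K) (i : n) : (fib K v x) i = v (x, i) := rfl

omit [DecidableEq n] in
/-- A component is bounded by the fibre norm: `|v(x,i)| ≤ ‖fib v x‖`. [folklore] -/
theorem norm_apply_le_norm_fib (v : Tor K × n → 𝕜) (x : Tor K) (i : n) : ‖v (x, i)‖ ≤ ‖fib K v x‖ :=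
  PiLp.norm_apply_le (fib K v x) i

/-- A UNITARY MATRIX IS AN ISOMETRY of `EuclideanSpace 𝕜 n`: `‖toEuclideanLin V w‖ = ‖w‖`. [folklore] -/
theorem norm_toEuclideanLin_of_mem_unitaryGroup {V : Matrix n n 𝕜} (hV : V ∈ Matrix.unitaryGroup n 𝕜) (w : EuclideanSpace 𝕜 n) :
    ‖Matrix.toEuclideanLin V w‖ = ‖w‖ := by
  have hVV : Vᴴ * V = 1 := by simpa only [star_eq_conjTranspose] using Matrix.mem_unitaryGroup_iff'.mp hV
  have h1 : (V *ᵥ ofLp w) ⬝ᵥ star (V *ᵥ ofLp w) = ofLp w ⬝ᵥ star (ofLp w) := by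
    rw [dotProduct_comm, star_mulVec, dotProduct_mulVec, vecMul_vecMul, hVV, vecMul_one, dotProduct_comm]
  have h2 : ‖Matrix.toEuclideanLin V w‖ ^ 2 = ‖w‖ ^ 2 := by
    rw [@norm_sq_eq_re_inner 𝕜, @norm_sq_eq_re_inner 𝕜, EuclideanSpace.inner_eq_star_dotProduct, EuclideanSpace.inner_eq_star_dotProduct,
      Matrix.toLpLin_apply, ofLp_toLp, h1]
  exact (sq_eq_sq₀ (norm_nonneg _) (norm_nonneg _)).mp h2

variable [hK : ∀ μ, NeZero (K μ)]

omit hK in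
/-- The transporters of a unitary link field are contractions (indeed isometries) — the hypothesis of Kato's inequality. [cite: DodziukMathai2006, Lemma 1.2 §1] -/
theorem norm_kingTransport_le {U : Tor K × Fin (d + 1) → Matrix n n 𝕜} (hU : ∀ b, U b ∈ Matrix.unitaryGroup n 𝕜)
    (x : Tor K) (j : Fin (d + 1) × Bool) (w : EuclideanSpace 𝕜 n) : ‖kingTransport K U x j w‖ ≤ ‖w‖ := by
  unfold kingTransport
  split_ifs
  · exact (norm_toEuclideanLin_of_mem_unitaryGroup (hU _) w).le
  · have h' : (U (x - unitVec K j.1, j.1))ᴴ ∈ Matrix.unitaryGroup n 𝕜 := by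
      simpa only [star_eq_conjTranspose] using Unitary.star_mem (hU _)
    exact (norm_toEuclideanLin_of_mem_unitaryGroup h' w).le

/-- ★ THE COVARIANT EQUATION IN KATO FORM: `M_U v = f` ⟹ at every site `Σ_{(μ,±)} c·(v(x) − T_{x,(μ,±)}v(x ± e_μ)) + m²·v(x) = f(x)` in the fibre `𝕜ⁿ` (PART Ͱ-a's stencil
`covLapF_mulVec_apply`, regrouped: `Σ_{(μ,±)} c = 2(d+1)c`). [cite: Balaban1985BackgroundPropagators, (3.23) p.394; King1986, (4.4) p.670] -/
theorem fib_eq_of_covLapF_mulVec (c m2 : ℝ) (U : Tor K × Fin (d + 1) → Matrix n n 𝕜) {v f : Tor K × n → 𝕜} (hv : covLapF K c m2 U *ᵥ v = f) (x : Tor K) :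
    ∑ j, (c : 𝕜) • (fib K v x - kingTransport K U x j (fib K v (kingNbr K x j))) + (m2 : 𝕜) • fib K v x = fib K f x := by
  have hx : ∀ i, f (x, i) = (covLapF K c m2 U *ᵥ v) (x, i) := fun i => by rw [hv]
  ext i
  simp only [WithLp.ofLp_add, WithLp.ofLp_smul, WithLp.ofLp_sum, WithLp.ofLp_sub, Pi.add_apply, Pi.smul_apply, Finset.sum_apply, Pi.sub_apply, fib,
    WithLp.ofLp_toLp, smul_eq_mul, hx i, covLapF_mulVec_apply]
  rw [Fintype.sum_prod_type]
  simp only [Fintype.sum_bool, kingTransport, kingNbr, if_true, Bool.false_eq_true, if_false, Matrix.toLpLin_apply, WithLp.ofLp_toLp]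
  have hreg : ∀ μ : Fin (d + 1), (c : 𝕜) * (v (x, i) - (U (x, μ) *ᵥ fun j => v (x + unitVec K μ, j)) i)
      + (c : 𝕜) * (v (x, i) - ((U (x - unitVec K μ, μ))ᴴ *ᵥ fun j => v (x - unitVec K μ, j)) i)
      = 2 * (c : 𝕜) * v (x, i) - (c : 𝕜) * ((U (x, μ) *ᵥ fun j => v (x + unitVec K μ, j)) i
        + ((U (x - unitVec K μ, μ))ᴴ *ᵥ fun j => v (x - unitVec K μ, j)) i) := fun μ => by ring
  simp only [hreg, Finset.sum_sub_distrib, Finset.sum_const, Finset.card_univ, Fintype.card_fin, nsmul_eq_mul, ← Finset.mul_sum]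
  push_cast; ring

/-- ★ KING's SCALAR EQUATION IN KATO FORM: `(c(−Δ)+m²)φ = g` ⟹ `Σ_{(μ,±)} c·(φ(x) − φ(x ± e_μ)) + m²·φ(x) = g(x)` (Ε-b's `lapF_mulVec_stencil`, regrouped).
[cite: King1986, (4.4) p.670] -/
theorem scalar_eq_of_lapF_mulVec (c m2 : ℝ) {φ g : Tor K → ℝ} (hφ : lapF K c m2 *ᵥ φ = g) (x : Tor K) :
    ∑ j, c * (φ x - φ (kingNbr K x j)) + m2 * φ x = g x := by
  rw [← hφ, lapF_mulVec_stencil K c m2 φ x, Fintype.sum_prod_type]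
  simp only [Fintype.sum_bool, kingNbr, if_true, Bool.false_eq_true, if_false]
  rw [add_comm, Finset.mul_sum]
  congr 1
  exact Finset.sum_congr rfl fun μ _ => by ring

end Data

/-! ## §2 Domination of `G_U f` by `G g` -/

section Domination

variable {𝕜 : Type*} [RCLike 𝕜] {n : Type*} [Fintype n] [DecidableEq n]
variable [hK : ∀ μ, NeZero (K μ)] {c m2 : ℝ}

/-- ★★★ **KATO DOMINATION ON KING's TORUS**: for every unitary link field `U`, `c ≥ 0`, `m² > 0`, every source `f` and scalar majorant `g` with `‖f(x)‖_{𝕜ⁿ} ≤ g(x)`: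
`‖((−cΔ_U+m²)⁻¹f)(x)‖_{𝕜ⁿ} ≤ ((c(−Δ)+m²)⁻¹g)(x)` at every site — King's `A = 0` covariance applied to the majorant majorises the covariant covariance applied to the source.
[cite: DodziukMathai2006, Thm 1.5 + Remark 1.6 §1; Balaban1985BackgroundPropagators, (3.23) p.394, (3.42) p.397; King1986, (4.4) p.670] -/
theorem norm_fib_inv_mulVec_le (hc : 0 ≤ c) (hm : 0 < m2) {U : Tor K × Fin (d + 1) → Matrix n n 𝕜} (hU : ∀ b, U b ∈ Matrix.unitaryGroup n 𝕜)
    {f : Tor K × n → 𝕜} {g : Tor K → ℝ} (hfg : ∀ x, ‖fib K f x‖ ≤ g x) (x : Tor K) :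
    ‖fib K ((covLapF K c m2 U)⁻¹ *ᵥ f) x‖ ≤ ((lapF K c m2)⁻¹ *ᵥ g) x := by
  have hv : covLapF K c m2 U *ᵥ ((covLapF K c m2 U)⁻¹ *ᵥ f) = f := by
    rw [mulVec_mulVec, covLapF_mul_inv K hc hm hU, one_mulVec]
  have hφ : lapF K c m2 *ᵥ ((lapF K c m2)⁻¹ *ᵥ g) = g := by
    rw [mulVec_mulVec, Matrix.mul_nonsing_inv _ (lapF_det_isUnit K hc hm), one_mulVec]
  exact norm_le_scalar_of_resolvent (kingNbr K) (fun _ _ => c) (fun _ _ => hc) (kingTransport K U) (norm_kingTransport_le K hU) hm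
    (fib_eq_of_covLapF_mulVec K c m2 U hv) (scalar_eq_of_lapF_mulVec K c m2 hφ) hfg x

/-- ★★ **THE SUP→SUP BOUND** `‖G_U‖_{∞→∞} ≤ m⁻²` at every unitary `U`: `‖f(y)‖ ≤ F` for all `y` ⟹ `‖(G_Uf)(x)‖ ≤ F∕m²` (Kato at a maximum point of `‖G_Uf‖`; the tree's
`norm_le_of_resolvent`). [cite: DodziukMathai2006, Lemma 1.1 §1; Balaban1985BackgroundPropagators, (3.39) p.397] -/
theorem norm_fib_inv_mulVec_le_div_mass (hc : 0 ≤ c) (hm : 0 < m2) {U : Tor K × Fin (d + 1) → Matrix n n 𝕜} (hU : ∀ b, U b ∈ Matrix.unitaryGroup n 𝕜)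
    {f : Tor K × n → 𝕜} {F : ℝ} (hF : ∀ y, ‖fib K f y‖ ≤ F) (x : Tor K) :
    ‖fib K ((covLapF K c m2 U)⁻¹ *ᵥ f) x‖ ≤ F / m2 := by
  have hv : covLapF K c m2 U *ᵥ ((covLapF K c m2 U)⁻¹ *ᵥ f) = f := by
    rw [mulVec_mulVec, covLapF_mul_inv K hc hm hU, one_mulVec]
  exact norm_le_of_resolvent (kingNbr K) (fun _ _ => c) (fun _ _ => hc) (kingTransport K U) (norm_kingTransport_le K hU) hm
    (fib_eq_of_covLapF_mulVec K c m2 U hv) hF x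

/-- `G(x,y) ≥ 0`: the columns of King's `A = 0` covariance are non-negative by the scalar maximum principle (the tree's `scalar_nonneg_of_resolvent`; cf. the seat's
`lapF_inv_nonneg` by the Z-matrix route). [cite: DodziukMathai2006, Lemma 1.1 §1; King1986, (4.4) p.670] -/
theorem lapF_inv_entry_nonneg (hc : 0 ≤ c) (hm : 0 < m2) (x y : Tor K) : 0 ≤ (lapF K c m2)⁻¹ x y := by
  have hφ : lapF K c m2 *ᵥ ((lapF K c m2)⁻¹ *ᵥ Pi.single y 1) = Pi.single y 1 := by
    rw [mulVec_mulVec, Matrix.mul_nonsing_inv _ (lapF_det_isUnit K hc hm), one_mulVec]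
  have h := scalar_nonneg_of_resolvent (kingNbr K) (fun _ _ => c) (fun _ _ => hc) hm (scalar_eq_of_lapF_mulVec K c m2 hφ)
    (fun z => by simp only [Pi.single_apply]; split_ifs <;> norm_num) x
  simpa only [mulVec_single_one, Matrix.col_apply] using h

end Domination

/-! ## §3 Blockwise and entrywise domination -/

section Blocks

variable {𝕜 : Type*} [RCLike 𝕜] {n : Type*} [Fintype n] [DecidableEq n]
variable [hK : ∀ μ, NeZero (K μ)] {c m2 : ℝ}

omit [DecidableEq n] hK in
/-- The fibres of the point source `δ_y ⊗ e`: `toLp e` at `y`, `0` elsewhere; hence `‖fib (δ_y ⊗ e) x‖ = [x = y]·‖toLp e‖`. [folklore] -/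
theorem norm_fib_pointSource (y : Tor K) (e : n → 𝕜) (x : Tor K) :
    ‖fib K (fun p : Tor K × n => if p.1 = y then e p.2 else 0) x‖ = (if x = y then 1 else 0) * ‖toLp 2 e‖ := by
  by_cases hxy : x = y
  · rw [if_pos hxy, one_mul]
    congr 1
    ext i
    simp [fib, hxy]
  · rw [if_neg hxy, zero_mul, norm_eq_zero]
    ext i
    simp [fib, hxy]

omit [DecidableEq n] in
/-- The fibre at `x` of `G(δ_y ⊗ e)` is the block `G_{xy}` applied to `e`. [folklore] -/
theorem fib_mulVec_pointSource (G : Matrix (Tor K × n) (Tor K × n) 𝕜) (y : Tor K) (e : n → 𝕜) (x : Tor K) :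
    fib K (G *ᵥ fun p : Tor K × n => if p.1 = y then e p.2 else 0) x = toLp 2 (blk G x y *ᵥ e) := by
  ext i
  simp only [fib_apply, Matrix.mulVec, dotProduct, blk, Matrix.of_apply]
  rw [Fintype.sum_prod_type, Finset.sum_eq_single y (fun z _ hz => by simp [hz]) (fun h => absurd (Finset.mem_univ _) h)]
  simp only [if_true]

/-- The `y`-column of King's covariance scaled by `r`: `(G (r·δ_y))(x) = G(x,y)·r`. [folklore] -/
theorem lapF_inv_mulVec_indicator (r : ℝ) (x y : Tor K) :
    ((lapF K c m2)⁻¹ *ᵥ fun z => (if z = y then 1 else 0) * r) x = (lapF K c m2)⁻¹ x y * r := by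
  have : (fun z : Tor K => (if z = y then (1 : ℝ) else 0) * r) = Pi.single y r := by
    funext z; simp only [Pi.single_apply, ite_mul, one_mul, zero_mul]
  rw [this, mulVec_single]
  simp [Matrix.col_apply]

/-- ★★★ **BLOCKWISE DOMINATION**: `‖(G_U)_{xy} e‖_{𝕜ⁿ} ≤ G(x,y)·‖e‖_{𝕜ⁿ}` for all sites `x, y`, all `e ∈ 𝕜ⁿ`, every unitary `U` (`c ≥ 0`, `m² > 0`).
[cite: DodziukMathai2006, Thm 1.5 + Remark 1.6 §1; Balaban1985BackgroundPropagators, (3.42) p.397; King1986, (4.4) p.670] -/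
theorem norm_blk_inv_mulVec_le (hc : 0 ≤ c) (hm : 0 < m2) {U : Tor K × Fin (d + 1) → Matrix n n 𝕜} (hU : ∀ b, U b ∈ Matrix.unitaryGroup n 𝕜)
    (x y : Tor K) (e : n → 𝕜) :
    ‖toLp 2 (blk ((covLapF K c m2 U)⁻¹) x y *ᵥ e)‖ ≤ (lapF K c m2)⁻¹ x y * ‖toLp 2 e‖ := by
  have h := norm_fib_inv_mulVec_le K hc hm hU (f := fun p : Tor K × n => if p.1 = y then e p.2 else 0)
    (g := fun z => (if z = y then 1 else 0) * ‖toLp 2 e‖) (fun z => (norm_fib_pointSource K y e z).le) x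
  rwa [fib_mulVec_pointSource, lapF_inv_mulVec_indicator] at h

/-- The same in `EuclideanSpace` language: `‖toEuclideanLin (G_U)_{xy} w‖ ≤ G(x,y)·‖w‖`. [cite: DodziukMathai2006, Thm 1.5 §1] -/
theorem norm_toEuclideanLin_blk_inv_le (hc : 0 ≤ c) (hm : 0 < m2) {U : Tor K × Fin (d + 1) → Matrix n n 𝕜} (hU : ∀ b, U b ∈ Matrix.unitaryGroup n 𝕜)
    (x y : Tor K) (w : EuclideanSpace 𝕜 n) :
    ‖Matrix.toEuclideanLin (blk ((covLapF K c m2 U)⁻¹) x y) w‖ ≤ (lapF K c m2)⁻¹ x y * ‖w‖ := by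
  have h := norm_blk_inv_mulVec_le K hc hm hU x y (ofLp w)
  rwa [toLp_ofLp] at h

/-- ★★★ **ENTRYWISE DOMINATION**: `|G_U((x,i),(y,j))| ≤ G(x,y)` — every matrix element of the covariant fine covariance at every unitary link field is bounded by the
corresponding entry of King's `A = 0` covariance. [cite: DodziukMathai2006, Thm 1.5 + Remark 1.6 §1; Balaban1985BackgroundPropagators, (3.42) p.397; King1986, (4.4) p.670] -/
theorem norm_inv_entry_le_lapF_inv (hc : 0 ≤ c) (hm : 0 < m2) {U : Tor K × Fin (d + 1) → Matrix n n 𝕜} (hU : ∀ b, U b ∈ Matrix.unitaryGroup n 𝕜)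
    (x y : Tor K) (i j : n) : ‖(covLapF K c m2 U)⁻¹ (x, i) (y, j)‖ ≤ (lapF K c m2)⁻¹ x y := by
  have h := norm_blk_inv_mulVec_le K hc hm hU x y (Pi.single j 1)
  rw [mulVec_single_one, PiLp.toLp_single, PiLp.norm_single, norm_one, mul_one] at h
  refine le_trans ?_ h
  have := PiLp.norm_apply_le (toLp 2 ((blk ((covLapF K c m2 U)⁻¹) x y).col j)) i
  simpa only [PiLp.toLp_apply, Matrix.col_apply, blk, Matrix.of_apply] using this

open scoped Matrix.Norms.L2Operator in
/-- ★★★ **OPERATOR-NORM DOMINATION OF THE BLOCKS**: in the `ℓ²(𝕜ⁿ) → ℓ²(𝕜ⁿ)` operator norm, `‖(G_U)_{xy}‖ ≤ G(x,y)` (Mathlib's `Matrix.Norms.L2Operator` instance).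
[cite: DodziukMathai2006, Thm 1.5 §1; Balaban1985BackgroundPropagators, (3.42) p.397] -/
theorem l2_opNorm_blk_inv_le (hc : 0 ≤ c) (hm : 0 < m2) {U : Tor K × Fin (d + 1) → Matrix n n 𝕜} (hU : ∀ b, U b ∈ Matrix.unitaryGroup n 𝕜)
    (x y : Tor K) : ‖blk ((covLapF K c m2 U)⁻¹) x y‖ ≤ (lapF K c m2)⁻¹ x y := by
  rw [Matrix.cstar_norm_def]
  refine ContinuousLinearMap.opNorm_le_bound _ (lapF_inv_entry_nonneg K hc hm x y) fun w => ?_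
  have hw : w = toLp 2 (ofLp w) := rfl
  rw [hw, Matrix.toEuclideanCLM_toLp]
  exact norm_blk_inv_mulVec_le K hc hm hU x y (ofLp w)

end Blocks

/-! ## §4 Consequences by name: the `A = 0` bounds hold verbatim at every `U` -/

section Consequences

variable {𝕜 : Type*} [RCLike 𝕜] {n : Type*} [Fintype n] [DecidableEq n]
variable [hK : ∀ μ, NeZero (K μ)] {c m2 : ℝ}

/-- ★★ `|G_U((x,i),(y,j))| ≤ G(x,x)` — the diagonal of King's covariance dominates every covariant entry (Ε-e `abs_lapF_inv_le_diag`). [cite: King1986, (4.4)∕(4.35) p.670∕674] -/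
theorem norm_inv_entry_le_diag (hc : 0 ≤ c) (hm : 0 < m2) {U : Tor K × Fin (d + 1) → Matrix n n 𝕜} (hU : ∀ b, U b ∈ Matrix.unitaryGroup n 𝕜)
    (x y : Tor K) (i j : n) : ‖(covLapF K c m2 U)⁻¹ (x, i) (y, j)‖ ≤ (lapF K c m2)⁻¹ x x :=
  (norm_inv_entry_le_lapF_inv K hc hm hU x y i j).trans ((le_abs_self _).trans (abs_lapF_inv_le_diag K hc hm x y))

/-- ★★ `|G_U((x,i),(y,j))| ≤ 1∕m²` at every unitary `U`, every torus (Ε-e `lapF_inv_diag_le_inv_mass`). [cite: King1986, (4.4) p.670] -/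
theorem norm_inv_entry_le_inv_mass (hc : 0 ≤ c) (hm : 0 < m2) {U : Tor K × Fin (d + 1) → Matrix n n 𝕜} (hU : ∀ b, U b ∈ Matrix.unitaryGroup n 𝕜)
    (x y : Tor K) (i j : n) : ‖(covLapF K c m2 U)⁻¹ (x, i) (y, j)‖ ≤ m2⁻¹ :=
  (norm_inv_entry_le_diag K hc hm hU x y i j).trans (lapF_inv_diag_le_inv_mass K hc hm x)

open scoped Matrix.Norms.L2Operator in
/-- ★★ `‖(G_U)_{xy}‖_{op} ≤ G(x,x) ≤ 1∕m²`. [cite: King1986, (4.4) p.670; Balaban1985BackgroundPropagators, (3.42) p.397] -/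
theorem l2_opNorm_blk_inv_le_inv_mass (hc : 0 ≤ c) (hm : 0 < m2) {U : Tor K × Fin (d + 1) → Matrix n n 𝕜} (hU : ∀ b, U b ∈ Matrix.unitaryGroup n 𝕜)
    (x y : Tor K) : ‖blk ((covLapF K c m2 U)⁻¹) x y‖ ≤ m2⁻¹ :=
  (l2_opNorm_blk_inv_le K hc hm hU x y).trans (((le_abs_self _).trans (abs_lapF_inv_le_diag K hc hm x y)).trans (lapF_inv_diag_le_inv_mass K hc hm x))

open scoped Matrix.Norms.L2Operator in
/-- ★ THE BLOCK SIZES ARE GAUGE INVARIANT: `‖(G_{U^g})_{xy}‖_{op} = ‖(G_U)_{xy}‖_{op}` for unitary-valued `g` (Ͱ-a `blk_covLapF_kingGaugeAct_inv` + unitary invariance of the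
operator norm). [cite: Balaban1985BackgroundPropagators, p.398 l.1–2] -/
theorem l2_opNorm_blk_inv_kingGaugeAct (hc : 0 ≤ c) (hm : 0 < m2) {g : Tor K → Matrix n n 𝕜} (hg : ∀ x, g x ∈ Matrix.unitaryGroup n 𝕜)
    {U : Tor K × Fin (d + 1) → Matrix n n 𝕜} (hU : ∀ b, U b ∈ Matrix.unitaryGroup n 𝕜) (x y : Tor K) :
    ‖blk ((covLapF K c m2 (kingGaugeAct K g U))⁻¹) x y‖ = ‖blk ((covLapF K c m2 U)⁻¹) x y‖ := by
  rw [blk_covLapF_kingGaugeAct_inv K hc hm hg hU x y]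
  have hx : g x ∈ unitary (Matrix n n 𝕜) := hg x
  have hy : (g y)ᴴ ∈ unitary (Matrix n n 𝕜) := by simpa only [star_eq_conjTranspose] using Unitary.star_mem (hg y)
  rw [CStarRing.norm_mul_mem_unitary _ hy, CStarRing.norm_mem_unitary_mul _ hx]

end Consequences

end Summit.QuantumFields.YangMills.BalabanUVNodes.N15KingModelRung.Covariant

end
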